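import Summits.CriticalPhenomena.PercolationContinuityZ3.Theorems.PercNearOneGluingNoHeavyLowerTailMajorityGluingHubOnly
import HarnessLib

/-!
# Majority gluing with loss `2·max` from the percolation Erdős–Ko–Rado bound at the SURVIVING sizes `|T| + 2 ≤ 2h`
# — the repaired (non-vacuous) uniform conditional (lane prim-rate, RULING 17 (a)(ii); rows M1-E1u′ ⟹ M1-H1(2) ⟹ M1-L2)

Support file for the closed crux `NoHeavyLowerTail` (stmt-CriticalPhenomena-4575), continuing
`PercNearOneGluingNoHeavyLowerTailMajorityGluingHubOnly.lean`.  There, `HubOnly.majorityGluing_two_of_percEKR` (p311309 :236) assumed the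
uniform percolation-EKR bound for EVERY `|T| < 2h`; the refuter seat showed (run/shared/lean/prim/prim-rate/refutations/M1-E1u.json,
exact) that the bare-majority size `|T| = 2h − 1` FAILS (twin pair + three-leaf block, `|T| = 5`, `h = 3`: `μ(#cut ≥ 3) = 17/32 > 1/2`),
so that hypothesis is false and :236 is vacuous as typed.  The proof of :236 consumed the refuted size only in the corner `a = a₀`
(`T = A ∖ {a₀}`).  Here the hypothesis is restricted to the sizes that survive every census, `|T| + 2 ≤ 2h` (row M1-E1u′), and the corner
is removed by PEELING one more relay: for every `a ∈ A` there is `c ∈ A ∖ {a₀}` with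
`H_a ⊆ {c ↮ a₀} ∪ {#cut(A ∖ {a₀, c}) ≥ ⌈|A|/2⌉}`, and `|A ∖ {a₀,c}| + 2 = |A| ≤ 2⌈|A|/2⌉`.  Hence
`μ(H_a) ≤ max + max = 2·max` (in the non-trivial regime `max ≤ 1/2`), i.e. majority gluing with loss `2·max` for every `|A|`, CONDITIONAL on
M1-E1u′ — a hypothesis that is attacked-clean (local) and not refuted.  No definitions, no named facts, no sorries.
[cite: KozmaNitzan2024, Conj. 1 (p. 3), Conj. 4 (p. 32)]
-/

noncomputable section

namespace Summit.CriticalPhenomena.PercolationContinuityZ3.Theorems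

open MeasureTheory Set
open Literature.Probability.LatticeModels (prodBernoulli)
open Literature.Probability.Percolation
open scoped Classical

namespace HubOnly

variable {n : ℕ}

/-- **MAJORITY GLUING WITH LOSS `2·max` FOR EVERY `|A|`, FROM THE PERCOLATION EKR BOUND AT SIZES `|T| + 2 ≤ 2h`** (repaired, non-vacuous
form of `majorityGluing_two_of_percEKR`; RULING 17 (a)(ii)).  HYPOTHESIS (row M1-E1u′, non-degenerate weights): for a hub `a₀ ∉ T`, `T ≠ ∅`,
`|T| + 2 ≤ 2h` and `μ(v ↮ a₀) ≤ 1/2` on `T`:  `μ(h ≤ #{v ∈ T : v ↮ a₀}) ≤ max_{v∈T} μ(v ↮ a₀)`.  CONCLUSION: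
`μ(o ↔ a₀ ∧ 2N > |A|) ≥ μ(o ↔ A) − 2·max_{a∈A} μ(a ↮ a₀)` for every relay set, hub, observer and weight function.  Proof: peel a relay
`c ≠ a₀` (`c = a` if `a ≠ a₀`): `H_a ⊆ {c ↮ a₀} ∪ {⌈|A|/2⌉ ≤ #cut(A ∖ {a₀,c})}` and `|A ∖ {a₀,c}| + 2 ≤ 2⌈|A|/2⌉`.
[cite: KozmaNitzan2024, Conj. 1 (p. 3), Conj. 4 (p. 32)] -/
theorem majorityGluing_two_of_percEKR_le
    (hEKR : ∀ (n : ℕ) (p : Sym2 (Fin n) → unitInterval), (∀ e, 0 < p e ∧ p e < 1) →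
      ∀ (T : Finset (Fin n)) (a₀ : Fin n) (h : ℕ) (hT : T.Nonempty), a₀ ∉ T → T.card + 2 ≤ 2 * h →
      (∀ v ∈ T, (prodBernoulli p).real (openConn v a₀ : Set (BondConfig (Fin n)))ᶜ ≤ 1 / 2) →
      (prodBernoulli p).real {ω : BondConfig (Fin n) | h ≤ (T.filter fun v => ω ∉ openConn v a₀).card}
        ≤ T.sup' hT (fun v => (prodBernoulli p).real (openConn v a₀ : Set (BondConfig (Fin n)))ᶜ))
    (n : ℕ) (w : Sym2 (Fin n) → unitInterval) (A : Finset (Fin n)) (o a₀ : Fin n) (δ₀ : ℝ)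
    (ha₀ : a₀ ∈ A) (hδ₀ : ∀ a ∈ A, (prodBernoulli w).real (openConn a a₀ : Set (BondConfig (Fin n)))ᶜ ≤ δ₀) :
    (prodBernoulli w).real (⋃ a ∈ A, openConn o a) - 2 * δ₀ ≤
      (prodBernoulli w).real {ω : BondConfig (Fin n) | ω ∈ openConn o a₀ ∧
          A.card < 2 * (A.filter fun a => ω ∈ openConn o a).card} := by
  have h := majorityGluing_of_hubOnly (n := n) 2 zero_le_two A a₀ ha₀ ?_ w o δ₀ hδ₀
  · linarith
  intro p hp a ha
  set μ := prodBernoulli p with hμ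
  set δ : Fin n → ℝ := fun x => μ.real (openConn x a₀ : Set (BondConfig (Fin n)))ᶜ with hδ
  set M := A.sup' ⟨a₀, ha₀⟩ δ with hM
  have hδle : ∀ x ∈ A, δ x ≤ M := fun x hx => Finset.le_sup' δ hx
  have hM0 : 0 ≤ M := le_trans measureReal_nonneg (hδle a₀ ha₀)
  set H : Set (BondConfig (Fin n)) := {ω | ω ∈ openConn a a₀ →
      2 * (A.filter fun a' => ω ∈ openConn a' a₀).card ≤ A.card} with hH
  by_cases hbig : 1 / 2 < M
  · have : μ.real H ≤ 1 := measureReal_le_one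
    linarith
  have hbig' : M ≤ 1 / 2 := not_lt.1 hbig
  by_cases hA1 : A.card = 1
  · -- `A = {a₀}`: the hub event is empty
    have haa : a = a₀ := by
      obtain ⟨x, hx⟩ := Finset.card_eq_one.1 hA1
      rw [hx] at ha ha₀
      rw [Finset.mem_singleton.1 ha, Finset.mem_singleton.1 ha₀]
    subst haa
    have hempty : H = ∅ := by
      ext ω
      simp only [hH, mem_setOf_eq, mem_empty_iff_false, iff_false, Classical.not_imp, not_le]
      refine ⟨(SimpleGraph.Reachable.refl _ : (openGraph ω).Reachable a a), ?_⟩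
      have h0 : a ∈ A.filter fun a' => ω ∈ openConn a' a :=
        Finset.mem_filter.2 ⟨ha, (SimpleGraph.Reachable.refl _ : (openGraph ω).Reachable a a)⟩
      have : 1 ≤ (A.filter fun a' => ω ∈ openConn a' a).card := Finset.card_pos.2 ⟨a, h0⟩
      omega
    rw [hempty, measureReal_empty]; linarith
  -- a relay `c ≠ a₀`, equal to `a` unless `a = a₀`
  obtain ⟨c, hcA, hca₀, hca⟩ : ∃ c ∈ A, c ≠ a₀ ∧ (a ≠ a₀ → c = a) := by
    by_cases haa : a = a₀
    · have hpos : 1 < A.card := by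
        have := Finset.card_pos.2 ⟨a₀, ha₀⟩; omega
      obtain ⟨c, hc, hne⟩ := Finset.exists_mem_ne hpos a₀
      exact ⟨c, hc, hne, fun h => (h haa).elim⟩
    · exact ⟨a, ha, haa, fun _ => rfl⟩
  set T : Finset (Fin n) := (A.erase a₀).erase c with hT
  set hh : ℕ := (A.card + 1) / 2 with hhh
  have hcT : c ∈ A.erase a₀ := Finset.mem_erase.2 ⟨hca₀, hcA⟩
  have hTcard : T.card + 2 = A.card := by
    have hk : 1 ≤ A.card := Finset.card_pos.2 ⟨a₀, ha₀⟩
    rw [hT, Finset.card_erase_of_mem hcT, Finset.card_erase_of_mem ha₀]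
    omega
  have hT2h : T.card + 2 ≤ 2 * hh := by rw [hTcard, hhh]; omega
  have hTA : T ⊆ A := (Finset.erase_subset _ _).trans (Finset.erase_subset _ _)
  have ha₀T : a₀ ∉ T := fun h' => Finset.ne_of_mem_erase (Finset.mem_of_mem_erase h') rfl |>.elim
  set K : Set (BondConfig (Fin n)) := {ω | hh ≤ (T.filter fun v => ω ∉ openConn v a₀).card} with hK
  -- `H ⊆ {c ↮ a₀} ∪ K`
  have hsub : H ⊆ (openConn c a₀ : Set (BondConfig (Fin n)))ᶜ ∪ K := by
    intro ω hω
    by_cases hcc : ω ∈ openConn c a₀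
    · right
      have haa : ω ∈ openConn a a₀ := by
        by_cases h' : a = a₀
        · rw [h']; exact (SimpleGraph.Reachable.refl _ : (openGraph ω).Reachable a₀ a₀)
        · rw [← hca h']; exact hcc
      have hle := hω haa
      have hsplit := Finset.card_filter_add_card_filter_not (s := A) (fun a' => ω ∈ openConn a' a₀)
      have hcut : (A.filter fun a' => ¬ ω ∈ openConn a' a₀) ⊆ T.filter fun v => ω ∉ openConn v a₀ := by
        intro x hx
        rw [Finset.mem_filter] at hx ⊢
        refine ⟨?_, hx.2⟩
        rw [hT, Finset.mem_erase, Finset.mem_erase]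
        refine ⟨?_, ?_, hx.1⟩
        · rintro rfl; exact hx.2 hcc
        · rintro rfl; exact hx.2 (SimpleGraph.Reachable.refl _ : (openGraph ω).Reachable x x)
      have hc := Finset.card_le_card hcut
      simp only [hK, mem_setOf_eq]
      omega
    · left; exact hcc
  have hKb : μ.real K ≤ M := by
    by_cases hTne : T.Nonempty
    · have hhalf : ∀ v ∈ T, δ v ≤ 1 / 2 := fun v hv => (hδle v (hTA hv)).trans hbig'
      exact (hEKR n p hp T a₀ hh hTne ha₀T hT2h hhalf).trans (Finset.sup'_le _ _ fun v hv => hδle v (hTA hv))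
    · rw [Finset.not_nonempty_iff_eq_empty] at hTne
      have hk : 1 ≤ A.card := Finset.card_pos.2 ⟨a₀, ha₀⟩
      have hh1 : 1 ≤ hh := by rw [hhh]; omega
      have : K = ∅ := by
        ext ω
        simp only [hK, mem_setOf_eq, mem_empty_iff_false, iff_false, not_le, hTne, Finset.filter_empty,
          Finset.card_empty]
        omega
      rw [this, measureReal_empty]; exact hM0
  calc μ.real H ≤ μ.real ((openConn c a₀ : Set (BondConfig (Fin n)))ᶜ ∪ K) := measureReal_mono hsub
    _ ≤ μ.real (openConn c a₀ : Set (BondConfig (Fin n)))ᶜ + μ.real K := measureReal_union_le _ _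
    _ ≤ M + M := add_le_add (hδle c hcA) hKb
    _ = 2 * M := by ring

end HubOnly

end Summit.CriticalPhenomena.PercolationContinuityZ3.Theorems

end
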